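import Mathlib
import HarnessLib

/-!
# Numerical helper lemmas (rational enclosures of real powers)

Topic `Literature/NumberTheory/LFunctions`. Elementary lemmas reducing bounds on `x^{m/n}`,
`x^{-m/n}`, `√x`, `exp`, `log` to inequalities between rational numbers (for the numerical
verification of Patel–Yang's constant). Everything PROVED. [folklore]
-/

noncomputable section

open Real

namespace Literature.NumberTheory.LFunctions
namespace VdC
namespace Num

/-- `x^p ≤ d` from `x^m ≤ d^n` (`p = m/n`). [folklore] -/
theorem rpow_le_of_pow_le {x d p : ℝ} {m n : ℕ} (hx : 0 ≤ x) (hd : 0 ≤ d) (hn : n ≠ 0)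
    (hp : p = (m : ℝ) / n) (h : x ^ m ≤ d ^ n) : x ^ p ≤ d := by
  have hn' : (0 : ℝ) < n := by exact_mod_cast Nat.pos_of_ne_zero hn
  have h1 : x ^ p = (x ^ m) ^ ((n : ℝ)⁻¹) := by
    rw [hp, ← Real.rpow_natCast, ← Real.rpow_mul hx]; congr 1
  rw [h1]
  calc (x ^ m) ^ ((n : ℝ)⁻¹) ≤ (d ^ n) ^ ((n : ℝ)⁻¹) :=
        Real.rpow_le_rpow (by positivity) h (by positivity)
    _ = d := Real.pow_rpow_inv_natCast hd hn

/-- `c ≤ x^p` from `c^n ≤ x^m` (`p = m/n`). [folklore] -/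
theorem le_rpow_of_pow_le {x c p : ℝ} {m n : ℕ} (hx : 0 ≤ x) (hc : 0 ≤ c) (hn : n ≠ 0)
    (hp : p = (m : ℝ) / n) (h : c ^ n ≤ x ^ m) : c ≤ x ^ p := by
  have h1 : x ^ p = (x ^ m) ^ ((n : ℝ)⁻¹) := by
    rw [hp, ← Real.rpow_natCast, ← Real.rpow_mul hx]; congr 1
  rw [h1]
  calc c = (c ^ n) ^ ((n : ℝ)⁻¹) := (Real.pow_rpow_inv_natCast hc hn).symm
    _ ≤ (x ^ m) ^ ((n : ℝ)⁻¹) := Real.rpow_le_rpow (by positivity) h (by positivity)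

/-- `x^{-p} ≤ d` from `1 ≤ d^n x^m` (`p = m/n`, `x, d > 0`). [folklore] -/
theorem rpow_neg_le_of {x d p : ℝ} {m n : ℕ} (hx : 0 < x) (hd : 0 < d) (hn : n ≠ 0)
    (hp : p = (m : ℝ) / n) (h : 1 ≤ d ^ n * x ^ m) : x ^ (-p) ≤ d := by
  rw [Real.rpow_neg hx.le, inv_le_comm₀ (Real.rpow_pos_of_pos hx _) hd]
  refine le_rpow_of_pow_le hx.le (by positivity) hn hp ?_
  rw [inv_pow, ← one_div, div_le_iff₀ (pow_pos hd n)]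
  nlinarith [h]

/-- `c ≤ x^{-p}` from `c^n x^m ≤ 1` (`p = m/n`, `x, c > 0`). [folklore] -/
theorem le_rpow_neg_of {x c p : ℝ} {m n : ℕ} (hx : 0 < x) (hc : 0 < c) (hn : n ≠ 0)
    (hp : p = (m : ℝ) / n) (h : c ^ n * x ^ m ≤ 1) : c ≤ x ^ (-p) := by
  rw [Real.rpow_neg hx.le, le_inv_comm₀ hc (Real.rpow_pos_of_pos hx _)]
  refine rpow_le_of_pow_le hx.le (by positivity) hn hp ?_
  rw [inv_pow, ← one_div, le_div_iff₀ (pow_pos hc n)]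
  nlinarith [h]

/-- `√x ≤ d` from `x ≤ d²` (`d ≥ 0`). [folklore] -/
theorem sqrt_le_of_le_sq {x d : ℝ} (hd : 0 ≤ d) (h : x ≤ d ^ 2) : Real.sqrt x ≤ d :=
  (Real.sqrt_le_sqrt h).trans_eq (Real.sqrt_sq hd)

/-- `c ≤ √x` from `c² ≤ x` (`c ≥ 0`). [folklore] -/
theorem le_sqrt_of_sq_le {x c : ℝ} (hc : 0 ≤ c) (h : c ^ 2 ≤ x) : c ≤ Real.sqrt x := by
  rw [← Real.sqrt_sq hc]; exact Real.sqrt_le_sqrt h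

/-- Monotonicity of `x ↦ x^p` (`p ≥ 0`) packaged with bounds. [folklore] -/
theorem rpow_le_rpow_of_le {x y p : ℝ} (hx : 0 ≤ x) (hxy : x ≤ y) (hp : 0 ≤ p) : x ^ p ≤ y ^ p :=
  Real.rpow_le_rpow hx hxy hp

/-- Antitonicity of `x ↦ x^{-p}` (`p ≥ 0`, `x > 0`). [folklore] -/
theorem rpow_neg_le_rpow_neg_of_le {x y p : ℝ} (hx : 0 < x) (hxy : x ≤ y) (hp : 0 ≤ p) :
    y ^ (-p) ≤ x ^ (-p) :=
  Real.rpow_le_rpow_of_nonpos hx hxy (by linarith)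

/-- `exp(-a) ≤ d` from `1 ≤ d · L` with `L ≤ exp a` (`d > 0`). [folklore] -/
theorem exp_neg_le_of {a d L : ℝ} (hd : 0 < d) (hL : L ≤ Real.exp a) (h : 1 ≤ d * L) : Real.exp (-a) ≤ d := by
  rw [Real.exp_neg, inv_le_comm₀ (Real.exp_pos a) hd]
  have : d⁻¹ ≤ L := by rw [inv_le_iff_one_le_mul₀ hd]; linarith
  exact this.trans hL

/-- `(1 + a/n)^n ≤ exp a` for `a ≥ 0`. [folklore] -/
theorem one_add_div_pow_le_exp {a : ℝ} (ha : 0 ≤ a) (n : ℕ) (hn : n ≠ 0) :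
    (1 + a / n) ^ n ≤ Real.exp a := by
  have h1 : (1 + a / n) ≤ Real.exp (a / n) := by linarith [Real.add_one_le_exp (a / n)]
  have h2 : (1 + a / n) ^ n ≤ (Real.exp (a / n)) ^ n := pow_le_pow_left₀ (by positivity) h1 n
  rw [← Real.exp_nat_mul] at h2
  have hn' : (n : ℝ) ≠ 0 := by exact_mod_cast hn
  rwa [mul_div_cancel₀ _ hn'] at h2

/-- `exp 56` powers: `(exp 56)^p = exp (56 p)`. [folklore] -/
theorem exp56_rpow (p : ℝ) : (Real.exp 56) ^ p = Real.exp (56 * p) := by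
  rw [← Real.exp_mul]

/-- Lower bound for a positive power: `1 + p(1 - ρ⁻¹) ≤ ρ^p` (`ρ ≥ 1`, `p ≥ 0`). [folklore] -/
theorem one_add_le_rpow {ρ p : ℝ} (hρ : 1 ≤ ρ) (hp : 0 ≤ p) : 1 + p * (1 - ρ⁻¹) ≤ ρ ^ p := by
  have hρ0 : 0 < ρ := by linarith
  have h1 : 1 - ρ⁻¹ ≤ Real.log ρ := Real.one_sub_inv_le_log_of_pos hρ0
  have h2 : p * Real.log ρ + 1 ≤ Real.exp (p * Real.log ρ) := Real.add_one_le_exp _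
  rw [Real.rpow_def_of_pos hρ0, mul_comm (Real.log ρ)]
  nlinarith [mul_le_mul_of_nonneg_left h1 hp]


/-- `exp a ≤ d` from `1 ≤ d (1 - a/n)^n` (`0 ≤ a < n`). [folklore] -/
theorem exp_le_of {a d : ℝ} {n : ℕ} (ha : 0 ≤ a) (hn : a < n) (hd : 0 < d) (h : 1 ≤ d * (1 - a / n) ^ n) :
    Real.exp a ≤ d := by
  have hn0 : (0 : ℝ) < n := lt_of_le_of_lt ha hn
  have h1 : 1 - a / n ≤ Real.exp (-(a / n)) := by linarith [Real.add_one_le_exp (-(a / n))]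
  have h0 : 0 ≤ 1 - a / n := by rw [sub_nonneg, div_le_one hn0]; exact hn.le
  have h2 : (1 - a / n) ^ n ≤ Real.exp (-a) := by
    have := pow_le_pow_left₀ h0 h1 n
    rw [← Real.exp_nat_mul] at this
    have e : (n : ℝ) * -(a / n) = -a := by field_simp
    rwa [e] at this
  have h3 : 1 ≤ d * Real.exp (-a) := h.trans (mul_le_mul_of_nonneg_left h2 hd.le)
  rw [Real.exp_neg] at h3
  rwa [← div_eq_mul_inv, one_le_div (Real.exp_pos a)] at h3

end Num
end VdC
end Literature.NumberTheory.LFunctions
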